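import Summits.NavierStokesRegularity.FluidComputer.ClayBlowupLocalZoomResidualTools
import Summits.NavierStokesRegularity.FluidComputer.ClayBlowupZoomTools
import Literature.Analysis.FluidPDE.ClassicalSolutionRescale
import HarnessLib

/-!
# THE TRUNCATED LOCAL ZOOM OF A CLAY BLOW-UP WITH FORCE: its Oseen perturbation is `O(√lag)`
# uniformly, with a coefficient that VANISHES on growing balls (the energy pays the far field)

Cell `ns-blowup`, seat `ns-blowup-ecbridge-2` (g11). LABEL: E–C typing (KERNEL — no named fact, no
new definition). WHAT THIS IS NOT: not Navier–Stokes evidence — a priori bounds for a rescaled,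
truncated copy of the velocity of the TYPE `ClayBlowup 1`; no inhabitant is claimed. Companion memo:
`run/shared/lean/pub/ns-blowup/ecbridge2/ECBRIDGE-2-MEMO-10.md`.

At local zoom data `(τ₀, y₀, M)` (`ClayBlowupLocalZoomData.lean`: `‖u‖ ≤ 4M` on
`[t_b, τ₀] × B(y₀, R/M)`) the zoom `w(σ, z) = M⁻¹ u(τ₀ + M⁻² σ, y₀ + M⁻¹ z)` is bounded by `4` on
`(−(τ₀ − t_b)M², 0] × B(0, R)` only. Truncate it by a Lipschitz cutoff `χ` of `B(0, R)` and DEFINE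
the perturbation of the Oseen identity of `w̃ = χ w` by the identity itself. With the true forced
residual `F` (`‖F‖ ≤ M⁻³ G_f · lag`, `ClayBlowup.norm_oseenResidual_le`, `oseenResidual_smul_stPull`):
`G̃ = [χ(z) e^{hΔ}w(s) − e^{hΔ}(χ w(s))] + [B(χw,χw) − χ(z) B(w,w)] + χ(z) F` — the heat COMMUTATOR
(`exists_norm_heatCommutator_three_le`), the Duhamel terms (bounded fields `32 C √lag` each; the
unbounded far inputs of `B(w,w)` cost `8192 C_K M𝓔/R⁴ · lag`, `exists_norm_oseenDuhamel_sub_le_of_eqOn_ball`),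
the force. `ClayBlowup.exists_local_zoom_residual_bounds` — CONSTANTS FIRST `P, Q ≥ 0` of `X` with
`Θ = 1/R + 1/R² + (1 + M)/R⁴ + M⁻¹`: (i) `‖G̃(s,t)(z)‖ ≤ (P + Q Θ) √(t − s)` for lags `≤ 1`, ALL `z`;
(ii) `‖G̃(s,t)(z)‖ ≤ Q Θ (√(t − s) + (t − s))` for EVERY lag when `‖z‖ ≤ R/4`. Along the data of
`exists_local_zoom_data` (`R_k ≥ (k+1)/2`, `(1 + M_k)/R_k⁴ ≤ 32/(k+1)³`), `Θ_k → 0`.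

References: Koch–Nadirashvili–Seregin–Šverák, Acta Math. 203 (2009), §6 (6.2)–(6.3), Lemma 6.1 and
proof of Thm. 6.2 [cite: KochNadirashviliSereginSverak2009, §6 (arXiv pp. 11–13)]; Koch–Tataru,
Adv. Math. 157 (2001), (14) [cite: KochTataruAdvMath2001, §3 (14)].
-/

noncomputable section

namespace Summit.NavierStokesRegularity.FluidComputer

open Set MeasureTheory Filter Topology Function Metric Real
open scoped ENNReal NNReal
open Literature.Analysis Literature.Analysis.FluidPDE
open Summit.NavierStokesRegularity.NavierStokesRegularity

namespace ClayBlowup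
set_option maxHeartbeats 800000 in
-- one long bookkeeping proof: four estimates assembled at every point
/-- **PERTURBATION BOUNDS FOR THE TRUNCATED LOCAL ZOOM, CONSTANTS FIRST** (no named fact). There are
`P, Q ≥ 0`, depending only on `X : ClayBlowup 1`, such that: for every centre `(τ₀, y₀)` with
`τ₀ < T`, base time `0 ≤ t_b < τ₀`, magnitude `M ≥ 1` and radius `R > 0` with `‖u‖ ≤ 4M` on
`[t_b, τ₀] × B(y₀, R/M)`, and every cutoff `χ : ℝ³ → [0,1]`, `χ = 1` on `B̄(0, R/2)`, `χ = 0` off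
`B(0, 3R/4)`, `(4/R)`-Lipschitz and continuous — with the zoom `w = M⁻¹ • stPull M⁻² M⁻¹ τ₀ y₀ u`,
its truncation `w̃ = χ • w` and `Θ = 1/R + 1/R² + (1 + M)/R⁴ + M⁻¹` — for all
`−(τ₀ − t_b) M² < s < t ≤ 0`: (i) if `t − s ≤ 1`, for every `z`,
`‖w̃(t,z) − e^{(t−s)Δ}w̃(s)(z) + B¹_s(w̃,w̃)(t)(z)‖ ≤ (P + Q Θ) √(t − s)`; (ii) for EVERY lag, whenever
`‖z‖ ≤ R/4`, the same quantity is `≤ Q Θ (√(t − s) + (t − s))`.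
[cite: KochNadirashviliSereginSverak2009, §6 (6.2)–(6.3), Lemma 6.1 and proof of Thm 6.2 (arXiv pp. 11–13)]
[cite: KochTataruAdvMath2001, §3 (14)] -/
theorem exists_local_zoom_residual_bounds (X : ClayBlowup 1) :
    ∃ P Q : ℝ, 0 ≤ P ∧ 0 ≤ Q ∧ ∀ {τ₀ t_b M R : ℝ} {y₀ : EuclideanSpace ℝ (Fin 3)}
      {χ : EuclideanSpace ℝ (Fin 3) → ℝ}, τ₀ < X.T → 0 ≤ t_b → t_b < τ₀ → 1 ≤ M → 0 < R → (∀ s ∈ Icc t_b τ₀, ∀ z ∈ ball y₀ (R / M), ‖X.u s z‖ ≤ 4 * M) →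
      (∀ y, 0 ≤ χ y ∧ χ y ≤ 1) → (∀ y, ‖y‖ ≤ R / 2 → χ y = 1) → (∀ y, 3 * R / 4 ≤ ‖y‖ → χ y = 0) →
      (∀ y z, |χ y - χ z| ≤ 4 / R * ‖y - z‖) → Continuous χ → ∀ s t : ℝ, -(τ₀ - t_b) * M ^ 2 < s → s < t → t ≤ 0 →
        let w : ℝ → EuclideanSpace ℝ (Fin 3) → EuclideanSpace ℝ (Fin 3) := M⁻¹ • stPull (M⁻¹ ^ 2) M⁻¹ τ₀ y₀ X.u
        let wt : ℝ → EuclideanSpace ℝ (Fin 3) → EuclideanSpace ℝ (Fin 3) := fun σ z => χ z • w σ z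
        (t - s ≤ 1 → ∀ z, ‖wt t z - UnboundedOperators.heatExtension (wt s) (t - s) z +
            oseenDuhamel 1 s wt wt t z‖ ≤ (P + Q * (1 / R + 1 / R ^ 2 + (1 + M) / R ^ 4 + M⁻¹)) * Real.sqrt (t - s)) ∧
        (∀ z, ‖z‖ ≤ R / 4 → ‖wt t z - UnboundedOperators.heatExtension (wt s) (t - s) z +
            oseenDuhamel 1 s wt wt t z‖ ≤ Q * (1 / R + 1 / R ^ 2 + (1 + M) / R ^ 4 + M⁻¹) * (Real.sqrt (t - s) + (t - s))) := by
  have hT := X.T_pos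
  obtain ⟨E, hEt, hE⟩ := X.energy_le one_pos
  obtain ⟨Gf, hGf0, hres⟩ := X.norm_oseenResidual_le one_pos
  obtain ⟨C, hC, hB⟩ := exists_norm_oseenDuhamel_bounded_le (E := EuclideanSpace ℝ (Fin 3))
  set E' : ℝ := E.toReal with hE'
  have hE'0 : 0 ≤ E' := ENNReal.toReal_nonneg
  obtain ⟨D₁, D₂, hD₁, hD₂, hcommTool⟩ := exists_norm_heatCommutator_three_le
  obtain ⟨CK, hCK, hlocTool⟩ := exists_norm_oseenDuhamel_sub_le_of_eqOn_ball
  obtain ⟨P, hP⟩ : ∃ P : ℝ, P = 64 * C := ⟨_, rfl⟩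
  obtain ⟨Q, hQ⟩ : ∃ Q : ℝ, Q = 4 * D₁ + 64 + D₂ * E' + 8192 * CK * E' + Gf := ⟨_, rfl⟩
  have hP0 : 0 ≤ P := by rw [hP]; positivity
  have hQ0 : 0 ≤ Q := by rw [hQ]; positivity
  refine ⟨P, Q, hP0, hQ0, ?_⟩
  intro τ₀ t_b M R y₀ χ hτ₀ htb0 htb hM hR h4 hχ01 hχ1 hχ0 hχL hχc s t hs hst ht0 w wt
  have hM0 : 0 < M := lt_of_lt_of_le one_pos hM
  have hc0 : 0 < M⁻¹ := inv_pos.2 hM0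
  have hc1 : M⁻¹ ≤ 1 := inv_le_one_of_one_le₀ hM
  have hcM : M⁻¹ * M = 1 := inv_mul_cancel₀ hM0.ne'
  have hh : 0 < t - s := sub_pos.2 hst
  have hsqrt0 : 0 < Real.sqrt (t - s) := Real.sqrt_pos.2 hh
  have hh_sqrt : t - s ≤ 1 → t - s ≤ Real.sqrt (t - s) := fun hlag => by
    rw [Real.le_sqrt hh.le hh.le]; nlinarith
  have hτ₀0 : 0 < τ₀ := lt_of_le_of_lt htb0 htb
  have hc2 : M⁻¹ ^ 2 * M ^ 2 = 1 := by rw [← mul_pow, hcM, one_pow]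
  have hphys : ∀ σ, -(τ₀ - t_b) * M ^ 2 < σ → σ ≤ 0 → τ₀ + M⁻¹ ^ 2 * σ ∈ Icc t_b τ₀ := by
    intro σ hσ hσ0
    constructor
    · have h1 : M⁻¹ ^ 2 * (-(τ₀ - t_b) * M ^ 2) < M⁻¹ ^ 2 * σ := mul_lt_mul_of_pos_left hσ (pow_pos hc0 2)
      have h2 : M⁻¹ ^ 2 * (-(τ₀ - t_b) * M ^ 2) = -(τ₀ - t_b) := by rw [show M⁻¹ ^ 2 * (-(τ₀ - t_b) * M ^ 2) = -(τ₀ - t_b) * (M⁻¹ ^ 2 * M ^ 2) by ring, hc2, mul_one]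
      linarith
    · nlinarith [pow_pos hc0 2]
  have hphysT : ∀ σ, -(τ₀ - t_b) * M ^ 2 < σ → σ ≤ 0 → τ₀ + M⁻¹ ^ 2 * σ ∈ Ico 0 X.T := fun σ hσ hσ0 =>
    ⟨htb0.trans (hphys σ hσ hσ0).1, (hphys σ hσ hσ0).2.trans_lt hτ₀⟩
  have hw_def : w = M⁻¹ • stPull (M⁻¹ ^ 2) M⁻¹ τ₀ y₀ X.u := rfl
  have hwt_def : wt = fun σ z => χ z • w σ z := rfl
  clear_value wt w
  have hw_apply : ∀ σ z, w σ z = M⁻¹ • X.u (τ₀ + M⁻¹ ^ 2 * σ) (y₀ + M⁻¹ • z) := fun σ z => by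
    rw [hw_def]; rfl
  have hwt_apply : ∀ σ z, wt σ z = χ z • w σ z := fun σ z => by rw [hwt_def]
  obtain ⟨gz, qz, hclz⟩ : ∃ (gz : ℝ → EuclideanSpace ℝ (Fin 3) → EuclideanSpace ℝ (Fin 3))
      (qz : ℝ → EuclideanSpace ℝ (Fin 3) → ℝ), IsClassicalNSSolutionOn (Ioc (-(τ₀ - t_b) * M ^ 2) 0) 1 gz w qz := by
    have hcl := X.classical.nsRescale_translate hc0 τ₀ y₀
    rw [← hw_def] at hcl
    refine ⟨_, _, hcl.mono (fun σ hσ => ?_) (uniqueDiffOn_Ioc _ _)⟩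
    exact hphysT σ hσ.1 hσ.2
  have hwc : ContinuousOn (uncurry w) (Ioc (-(τ₀ - t_b) * M ^ 2) 0 ×ˢ univ) :=
    hclz.smooth_velocity.continuousOn
  have hwslice : ∀ σ ∈ Ioc (-(τ₀ - t_b) * M ^ 2) 0, Continuous (w σ) := fun σ hσ =>
    (hclz.contDiff_velocity hσ).continuous
  have hsub : Ioo s t ×ˢ (univ : Set (EuclideanSpace ℝ (Fin 3))) ⊆ Ioc (-(τ₀ - t_b) * M ^ 2) 0 ×ˢ univ :=
    Set.prod_mono (fun σ hσ => ⟨hs.trans hσ.1, (hσ.2.trans_le ht0).le⟩) subset_rfl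
  have hwm : AEStronglyMeasurable (uncurry w)
      ((volume : Measure (ℝ × EuclideanSpace ℝ (Fin 3))).restrict (Ioo s t ×ˢ univ)) :=
    (hwc.mono hsub).aestronglyMeasurable (measurableSet_Ioo.prod MeasurableSet.univ)
  have hwtm : AEStronglyMeasurable (uncurry wt)
      ((volume : Measure (ℝ × EuclideanSpace ℝ (Fin 3))).restrict (Ioo s t ×ˢ univ)) := by
    have h0 : uncurry wt = fun p : ℝ × EuclideanSpace ℝ (Fin 3) => χ p.2 • uncurry w p := by funext p; rw [hwt_def]; rfl
    have h1 : ContinuousOn (fun p : ℝ × EuclideanSpace ℝ (Fin 3) => χ p.2 • uncurry w p)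
        (Ioo s t ×ˢ univ) := ((hχc.comp continuous_snd).continuousOn).smul (hwc.mono hsub)
    rw [h0]
    exact h1.aestronglyMeasurable (measurableSet_Ioo.prod MeasurableSet.univ)
  have hw4 : ∀ σ, -(τ₀ - t_b) * M ^ 2 < σ → σ ≤ 0 → ∀ z, ‖z‖ < R → ‖w σ z‖ ≤ 4 := by
    intro σ hσ hσ0 z hz
    rw [hw_apply, norm_smul, Real.norm_of_nonneg hc0.le]
    have hball : y₀ + M⁻¹ • z ∈ ball y₀ (R / M) := by
      rw [mem_ball, dist_eq_norm, add_sub_cancel_left, norm_smul, Real.norm_of_nonneg hc0.le, div_eq_inv_mul]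
      exact mul_lt_mul_of_pos_left hz hc0
    have h := h4 _ (hphys σ hσ hσ0) _ hball
    calc M⁻¹ * ‖X.u (τ₀ + M⁻¹ ^ 2 * σ) (y₀ + M⁻¹ • z)‖ ≤ M⁻¹ * (4 * M) := mul_le_mul_of_nonneg_left h hc0.le
      _ = 4 := by rw [← mul_assoc, mul_comm M⁻¹, mul_assoc, mul_comm M⁻¹]; rw [mul_inv_cancel₀ hM0.ne', mul_one]
  obtain ⟨N, hN⟩ := X.exists_norm_le one_pos hτ₀
  set Nw : ℝ := max (M⁻¹ * N) 4 with hNw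
  have hNw4 : 4 ≤ Nw := le_max_right _ _
  have hNw0 : 0 ≤ Nw := le_trans (by norm_num) hNw4
  have hwN : ∀ σ, -(τ₀ - t_b) * M ^ 2 < σ → σ ≤ 0 → ∀ z, ‖w σ z‖ ≤ Nw := by
    intro σ hσ hσ0 z
    rw [hw_apply, norm_smul, Real.norm_of_nonneg hc0.le]
    have ht' := hphysT σ hσ hσ0
    exact (mul_le_mul_of_nonneg_left (hN _ ⟨ht'.1, (hphys σ hσ hσ0).2⟩ _) hc0.le).trans
      (le_max_left _ _)
  have hχsupp : ∀ y, χ y ≠ 0 → ‖y‖ < R - R / 4 := by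
    intro y hy
    have : ¬ 3 * R / 4 ≤ ‖y‖ := fun h => hy (hχ0 y h)
    push Not at this
    linarith
  have hwt4 : ∀ σ, -(τ₀ - t_b) * M ^ 2 < σ → σ ≤ 0 → ∀ z, ‖wt σ z‖ ≤ 4 := by
    intro σ hσ hσ0 z
    rw [hwt_apply, norm_smul, Real.norm_of_nonneg (hχ01 z).1]
    by_cases hz : χ z = 0
    · rw [hz, zero_mul]; norm_num
    · have hzR : ‖z‖ < R := (hχsupp z hz).trans (by linarith)
      calc χ z * ‖w σ z‖ ≤ 1 * 4 := mul_le_mul (hχ01 z).2 (hw4 σ hσ hσ0 z hzR) (norm_nonneg _) zero_le_one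
        _ = 4 := one_mul _
  have hEw : ∀ σ, -(τ₀ - t_b) * M ^ 2 < σ → σ ≤ 0 → ∫⁻ z, ‖w σ z‖ₑ ^ 2 ≤ ENNReal.ofReal M * E := by
    intro σ hσ hσ0
    have h := lintegral_zoom_slice_sq_le hM0 (τ₀ + M⁻¹ ^ 2 * σ) y₀ X.u (hE _ (hphysT σ hσ hσ0))
    simpa only [hw_apply] using h
  have hEwt : ∀ σ, -(τ₀ - t_b) * M ^ 2 < σ → σ ≤ 0 → ∫⁻ z, ‖wt σ z‖ₑ ^ 2 ≤ ENNReal.ofReal M * E := by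
    intro σ hσ hσ0
    refine (lintegral_mono fun z => ?_).trans (hEw σ hσ hσ0)
    have h1 : ‖wt σ z‖ₑ ≤ ‖w σ z‖ₑ := by
      rw [← ofReal_norm, ← ofReal_norm, hwt_apply, norm_smul, Real.norm_of_nonneg (hχ01 z).1]
      exact ENNReal.ofReal_le_ofReal (mul_le_of_le_one_left (norm_nonneg _) (hχ01 z).2)
    exact pow_le_pow_left' h1 2
  have hME : ENNReal.ofReal M * E ≠ ⊤ := ENNReal.mul_ne_top ENNReal.ofReal_ne_top hEt.ne
  have hMEreal : (ENNReal.ofReal M * E).toReal = M * E' := by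
    rw [ENNReal.toReal_mul, ENNReal.toReal_ofReal hM0.le]
  have hF : ∀ z, ‖w t z - UnboundedOperators.heatExtension (w s) (t - s) z +
      oseenDuhamel 1 s w w t z‖ ≤ M⁻¹ ^ 3 * (t - s) * Gf := by
    intro z
    have hs' := hphysT s hs (hst.le.trans ht0)
    have ht' := hphysT t (hs.trans hst) ht0
    have hss' : τ₀ + M⁻¹ ^ 2 * s < τ₀ + M⁻¹ ^ 2 * t := by nlinarith [pow_pos hc0 2]
    have key := norm_oseenResidual_smul_stPull_le hc0 τ₀ y₀ X.u hst z
      (hres _ _ hs'.1 hss' ht'.2 (y₀ + M⁻¹ • z))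
    rw [← hw_def] at key
    exact key
  have hc3 : M⁻¹ ^ 3 ≤ M⁻¹ := by
    have : M⁻¹ ^ 2 ≤ 1 := pow_le_one₀ hc0.le hc1
    nlinarith
  have hFle' : ∀ z, ‖w t z - UnboundedOperators.heatExtension (w s) (t - s) z +
      oseenDuhamel 1 s w w t z‖ ≤ Gf * M⁻¹ * (t - s) := by
    intro z
    refine (hF z).trans ?_
    calc M⁻¹ ^ 3 * (t - s) * Gf ≤ M⁻¹ * (t - s) * Gf := by gcongr
      _ = Gf * M⁻¹ * (t - s) := by ring
  have hFle : t - s ≤ 1 → ∀ z, ‖w t z - UnboundedOperators.heatExtension (w s) (t - s) z +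
      oseenDuhamel 1 s w w t z‖ ≤ Gf * M⁻¹ * Real.sqrt (t - s) := by
    intro hlag z
    refine (hFle' z).trans ?_
    have := hh_sqrt hlag
    have : 0 ≤ Gf * M⁻¹ := by positivity
    nlinarith
  have hB4 : ∀ {v : ℝ → EuclideanSpace ℝ (Fin 3) → EuclideanSpace ℝ (Fin 3)}, (∀ σ ∈ Ioo s t, ∀ y, ‖v σ y‖ ≤ 4) → ∀ z, ‖oseenDuhamel 1 s v v t z‖ ≤ 32 * C * Real.sqrt (t - s) := by
    intro v hv z
    have h := hB one_pos hst (by norm_num : (0 : ℝ) ≤ 4) hv hv z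
    rw [Real.one_rpow] at h
    linarith
  have hwt4' : ∀ σ ∈ Ioo s t, ∀ y, ‖wt σ y‖ ≤ 4 := fun σ hσ y =>
    hwt4 σ (hs.trans hσ.1) (hσ.2.le.trans ht0) y
  have hwN' : ∀ σ ∈ Ioo s t, ∀ y, ‖w σ y‖ ≤ Nw := fun σ hσ y =>
    hwN σ (hs.trans hσ.1) (hσ.2.le.trans ht0) y
  have hwtN' : ∀ σ ∈ Ioo s t, ∀ y, ‖wt σ y‖ ≤ Nw := fun σ hσ y => (hwt4' σ hσ y).trans hNw4
  have hcomm : ∀ z, ‖χ z • UnboundedOperators.heatExtension (w s) (t - s) z -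
      UnboundedOperators.heatExtension (wt s) (t - s) z‖ ≤ (4 * D₁ * (1 / R) + D₂ * E' * ((1 + M) / R ^ 4)) * Real.sqrt (t - s) +
        64 * (1 / R ^ 2) * (t - s) := by
    intro z
    have hs0 : s ≤ 0 := hst.le.trans ht0
    have hfc : Continuous (w s) := hwslice s ⟨hs, hs0⟩
    obtain ⟨hfi, hfE⟩ := integrable_sq_norm_of_lintegral_le hfc hME (hEw s hs hs0)
    rw [hMEreal] at hfE
    have key := hcommTool hh hR (by norm_num : (0 : ℝ) ≤ 4) (by positivity : 0 ≤ M * E') hχ01 hχ0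
      hχL hχc hfc (hwN s hs hs0) (fun y hy => hw4 s hs hs0 y hy) hfi hfE z
    have hwts : (fun y => χ y • w s y) = wt s := funext fun y => (hwt_apply s y).symm
    rw [hwts] at key
    refine key.trans ?_
    have h1 : D₁ * 4 / R = 4 * D₁ * (1 / R) := by ring
    have h2 : D₂ * (M * E') / R ^ 4 ≤ D₂ * E' * ((1 + M) / R ^ 4) := by
      rw [div_eq_mul_one_div]
      have h3 : M * E' ≤ E' * (1 + M) := by nlinarith only [hE'0, hM0]
      calc D₂ * (M * E') * (1 / R ^ 4) ≤ D₂ * (E' * (1 + M)) * (1 / R ^ 4) := by gcongr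
        _ = D₂ * E' * ((1 + M) / R ^ 4) := by ring
    have h4 : 64 * (t - s) / R ^ 2 = 64 * (1 / R ^ 2) * (t - s) := by ring
    nlinarith only [h1, h2, h4, hsqrt0]
  have hlocal : ∀ {v v' : ℝ → EuclideanSpace ℝ (Fin 3) → EuclideanSpace ℝ (Fin 3)} (z : EuclideanSpace ℝ (Fin 3)),
      AEStronglyMeasurable (uncurry v) ((volume : Measure (ℝ × EuclideanSpace ℝ (Fin 3))).restrict (Ioo s t ×ˢ univ)) →
      AEStronglyMeasurable (uncurry v') ((volume : Measure (ℝ × EuclideanSpace ℝ (Fin 3))).restrict (Ioo s t ×ˢ univ)) →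
      (∀ σ ∈ Ioo s t, ∀ y, ‖v σ y‖ ≤ Nw) → (∀ σ ∈ Ioo s t, ∀ y, ‖v' σ y‖ ≤ Nw) → (∀ σ ∈ Ioo s t, ∀ y, y ∈ ball z (R / 4) → v' σ y = v σ y) →
      (∀ σ ∈ Ioo s t, ∫⁻ y, ‖v σ y‖ₑ ^ 2 ≤ ENNReal.ofReal M * E) → (∀ σ ∈ Ioo s t, ∫⁻ y, ‖v' σ y‖ₑ ^ 2 ≤ ENNReal.ofReal M * E) →
      ‖oseenDuhamel 1 s v v t z - oseenDuhamel 1 s v' v' t z‖ ≤ 8192 * CK * E' * ((1 + M) / R ^ 4) * (t - s) := by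
    intro v v' z hvm hv'm hvN hv'N hagree hEv hEv'
    have key := hlocTool z hst hNw0 hR hM0 hEt.ne hvm hv'm hvN hv'N hagree hEv hEv'
    refine key.trans ?_
    have h3 : M / R ^ 4 ≤ (1 + M) / R ^ 4 := div_le_div_of_nonneg_right (by linarith) (by positivity)
    gcongr
  have hdecomp : ∀ z, wt t z - UnboundedOperators.heatExtension (wt s) (t - s) z +
      oseenDuhamel 1 s wt wt t z = (χ z • UnboundedOperators.heatExtension (w s) (t - s) z -
        UnboundedOperators.heatExtension (wt s) (t - s) z) +
      (oseenDuhamel 1 s wt wt t z - χ z • oseenDuhamel 1 s w w t z) +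
      χ z • (w t z - UnboundedOperators.heatExtension (w s) (t - s) z + oseenDuhamel 1 s w w t z) := by
    intro z
    rw [hwt_apply t z, smul_add, smul_sub]
    abel
  have hQdom : 4 * D₁ * (1 / R) + 64 * (1 / R ^ 2) + (D₂ * E' + 8192 * CK * E') * ((1 + M) / R ^ 4) +
      Gf * M⁻¹ ≤ Q * (1 / R + 1 / R ^ 2 + (1 + M) / R ^ 4 + M⁻¹) := by
    have h1 : 0 ≤ 1 / R := by positivity
    have h1' : 0 ≤ 1 / R ^ 2 := by positivity
    have h2 : 0 ≤ (1 + M) / R ^ 4 := by positivity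
    have h3 : 0 ≤ M⁻¹ := hc0.le
    have hq1 : 4 * D₁ ≤ Q := by rw [hQ]; nlinarith only [hD₂, hE'0, hCK.le, hGf0]
    have hq1' : (64 : ℝ) ≤ Q := by rw [hQ]; nlinarith only [hD₁, hD₂, hE'0, hCK.le, hGf0]
    have hq2 : D₂ * E' + 8192 * CK * E' ≤ Q := by rw [hQ]; nlinarith only [hD₁, hGf0]
    have hq3 : Gf ≤ Q := by rw [hQ]; nlinarith only [hD₁, hD₂, hE'0, hCK.le]
    calc 4 * D₁ * (1 / R) + 64 * (1 / R ^ 2) + (D₂ * E' + 8192 * CK * E') * ((1 + M) / R ^ 4) + Gf * M⁻¹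
        ≤ Q * (1 / R) + Q * (1 / R ^ 2) + Q * ((1 + M) / R ^ 4) + Q * M⁻¹ := add_le_add (add_le_add (add_le_add (mul_le_mul_of_nonneg_right hq1 h1)
            (mul_le_mul_of_nonneg_right hq1' h1')) (mul_le_mul_of_nonneg_right hq2 h2))
            (mul_le_mul_of_nonneg_right hq3 h3)
      _ = Q * (1 / R + 1 / R ^ 2 + (1 + M) / R ^ 4 + M⁻¹) := by ring
  have hΘ0 : 0 ≤ 1 / R + 1 / R ^ 2 + (1 + M) / R ^ 4 + M⁻¹ := by positivity
  refine ⟨fun hlag z => ?_, fun z hz => ?_⟩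
  · rw [hdecomp z]
    set wb : ℝ → EuclideanSpace ℝ (Fin 3) → EuclideanSpace ℝ (Fin 3) := fun σ y =>
      (univ ×ˢ ball (0 : EuclideanSpace ℝ (Fin 3)) R).indicator (uncurry w) (σ, y) with hwb
    have hwb_in : ∀ σ y, y ∈ ball (0 : EuclideanSpace ℝ (Fin 3)) R → wb σ y = w σ y := fun σ y hy => by
      simp only [hwb, indicator_of_mem (show (σ, y) ∈ univ ×ˢ ball (0 : EuclideanSpace ℝ (Fin 3)) R from
        ⟨mem_univ _, hy⟩), uncurry_apply_pair]
    have hwb_out : ∀ σ y, y ∉ ball (0 : EuclideanSpace ℝ (Fin 3)) R → wb σ y = 0 := fun σ y hy => by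
      simp only [hwb, indicator_of_notMem (show (σ, y) ∉ univ ×ˢ ball (0 : EuclideanSpace ℝ (Fin 3)) R from
        fun h => hy h.2)]
    have hwb4 : ∀ σ ∈ Ioo s t, ∀ y, ‖wb σ y‖ ≤ 4 := by
      intro σ hσ y
      by_cases hy : y ∈ ball (0 : EuclideanSpace ℝ (Fin 3)) R
      · rw [hwb_in σ y hy]
        exact hw4 σ (hs.trans hσ.1) (hσ.2.le.trans ht0) y (mem_ball_zero_iff.1 hy)
      · rw [hwb_out σ y hy, norm_zero]; norm_num
    have hwbN : ∀ σ ∈ Ioo s t, ∀ y, ‖wb σ y‖ ≤ Nw := fun σ hσ y => (hwb4 σ hσ y).trans hNw4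
    have hwbm : AEStronglyMeasurable (uncurry wb)
        ((volume : Measure (ℝ × EuclideanSpace ℝ (Fin 3))).restrict (Ioo s t ×ˢ univ)) :=
      (hwm.indicator (MeasurableSet.univ.prod measurableSet_ball :
        MeasurableSet (univ ×ˢ ball (0 : EuclideanSpace ℝ (Fin 3)) R))).congr (Eventually.of_forall fun p => rfl)
    have hEwb : ∀ σ ∈ Ioo s t, ∫⁻ y, ‖wb σ y‖ₑ ^ 2 ≤ ENNReal.ofReal M * E := by
      intro σ hσ
      refine (lintegral_mono fun y => ?_).trans (hEw σ (hs.trans hσ.1) (hσ.2.le.trans ht0))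
      have h1 : ‖wb σ y‖ₑ ≤ ‖w σ y‖ₑ := by
        rw [← ofReal_norm, ← ofReal_norm]
        refine ENNReal.ofReal_le_ofReal ?_
        by_cases hy : y ∈ ball (0 : EuclideanSpace ℝ (Fin 3)) R
        · rw [hwb_in σ y hy]
        · rw [hwb_out σ y hy, norm_zero]; exact norm_nonneg _
      exact pow_le_pow_left' h1 2
    have hχB : ‖χ z • oseenDuhamel 1 s w w t z‖ ≤ (32 * C + 8192 * CK * E' * ((1 + M) / R ^ 4)) * Real.sqrt (t - s) := by
      by_cases hχz : χ z = 0
      · rw [hχz, zero_smul, norm_zero]; positivity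
      · have hzR : ‖z‖ < 3 * R / 4 := by
          have : ¬ 3 * R / 4 ≤ ‖z‖ := fun h' => hχz (hχ0 z h'); push Not at this; exact this
        rw [norm_smul, Real.norm_of_nonneg (hχ01 z).1]
        have hdiff := hlocal z hwm hwbm hwN' hwbN (fun σ hσ y hy => hwb_in σ y (by
            rw [mem_ball_zero_iff]
            calc ‖y‖ ≤ ‖y - z‖ + ‖z‖ := norm_le_norm_sub_add y z
              _ < R / 4 + 3 * R / 4 := add_lt_add (by rwa [← dist_eq_norm, ← mem_ball]) hzR
              _ = R := by ring))
          (fun σ hσ => hEw σ (hs.trans hσ.1) (hσ.2.le.trans ht0)) hEwb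
        have h1 : ‖oseenDuhamel 1 s w w t z‖ ≤ ‖oseenDuhamel 1 s w w t z - oseenDuhamel 1 s wb wb t z‖ +
            ‖oseenDuhamel 1 s wb wb t z‖ := norm_le_norm_sub_add _ _
        have hdiff' : ‖oseenDuhamel 1 s w w t z - oseenDuhamel 1 s wb wb t z‖ ≤ 8192 * CK * E' * ((1 + M) / R ^ 4) * Real.sqrt (t - s) := by
          refine hdiff.trans ?_
          have := hh_sqrt hlag
          have : 0 ≤ 8192 * CK * E' * ((1 + M) / R ^ 4) := by positivity
          nlinarith
        calc χ z * ‖oseenDuhamel 1 s w w t z‖ ≤ 1 * ‖oseenDuhamel 1 s w w t z‖ := mul_le_mul_of_nonneg_right (hχ01 z).2 (norm_nonneg _)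
          _ ≤ 8192 * CK * E' * ((1 + M) / R ^ 4) * Real.sqrt (t - s) + 32 * C * Real.sqrt (t - s) := by rw [one_mul]; exact h1.trans (add_le_add hdiff' (hB4 hwb4 z))
          _ = _ := by ring
    have hBt : ‖oseenDuhamel 1 s wt wt t z‖ ≤ 32 * C * Real.sqrt (t - s) := hB4 hwt4' z
    have hχF : ‖χ z • (w t z - UnboundedOperators.heatExtension (w s) (t - s) z +
        oseenDuhamel 1 s w w t z)‖ ≤ Gf * M⁻¹ * Real.sqrt (t - s) := by
      rw [norm_smul, Real.norm_of_nonneg (hχ01 z).1]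
      calc χ z * _ ≤ 1 * _ := mul_le_mul (hχ01 z).2 (hFle hlag z) (norm_nonneg _) zero_le_one
        _ = _ := one_mul _
    have hcommz : ‖χ z • UnboundedOperators.heatExtension (w s) (t - s) z -
        UnboundedOperators.heatExtension (wt s) (t - s) z‖ ≤ (4 * D₁ * (1 / R) + 64 * (1 / R ^ 2) + D₂ * E' * ((1 + M) / R ^ 4)) * Real.sqrt (t - s) := by
      refine (hcomm z).trans ?_
      have := hh_sqrt hlag
      have h0 : (0 : ℝ) ≤ 64 * (1 / R ^ 2) := by positivity
      nlinarith [hsqrt0]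
    calc ‖(χ z • UnboundedOperators.heatExtension (w s) (t - s) z -
            UnboundedOperators.heatExtension (wt s) (t - s) z) +
          (oseenDuhamel 1 s wt wt t z - χ z • oseenDuhamel 1 s w w t z) +
          χ z • (w t z - UnboundedOperators.heatExtension (w s) (t - s) z + oseenDuhamel 1 s w w t z)‖
        ≤ ‖χ z • UnboundedOperators.heatExtension (w s) (t - s) z -
            UnboundedOperators.heatExtension (wt s) (t - s) z‖ +
          (‖oseenDuhamel 1 s wt wt t z‖ + ‖χ z • oseenDuhamel 1 s w w t z‖) +
          ‖χ z • (w t z - UnboundedOperators.heatExtension (w s) (t - s) z + oseenDuhamel 1 s w w t z)‖ :=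
          (norm_add_le _ _).trans (add_le_add ((norm_add_le _ _).trans (add_le_add le_rfl
            (norm_sub_le _ _))) le_rfl)
      _ ≤ (4 * D₁ * (1 / R) + 64 * (1 / R ^ 2) + D₂ * E' * ((1 + M) / R ^ 4)) * Real.sqrt (t - s) +
          (32 * C * Real.sqrt (t - s) + (32 * C + 8192 * CK * E' * ((1 + M) / R ^ 4)) * Real.sqrt (t - s)) +
          Gf * M⁻¹ * Real.sqrt (t - s) := add_le_add (add_le_add hcommz (add_le_add hBt hχB)) hχF
      _ = (P + (4 * D₁ * (1 / R) + 64 * (1 / R ^ 2) + (D₂ * E' + 8192 * CK * E') * ((1 + M) / R ^ 4) +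
          Gf * M⁻¹)) * Real.sqrt (t - s) := by rw [hP]; ring
      _ ≤ (P + Q * (1 / R + 1 / R ^ 2 + (1 + M) / R ^ 4 + M⁻¹)) * Real.sqrt (t - s) := by
          refine mul_le_mul_of_nonneg_right (add_le_add le_rfl ?_) (Real.sqrt_nonneg _)
          exact hQdom
  · -- ### (ii) the small bound on `B̄(0, R/4)`
    rw [hdecomp z]
    have hχz : χ z = 1 := hχ1 z (hz.trans (by linarith))
    simp only [hχz, one_smul]
    have hdiff := hlocal z hwm hwtm hwN' hwtN' (fun σ hσ y hy => by
        rw [hwt_apply, hχ1 y ?_, one_smul]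
        calc ‖y‖ ≤ ‖y - z‖ + ‖z‖ := norm_le_norm_sub_add y z
          _ ≤ R / 4 + R / 4 := add_le_add (by rw [← dist_eq_norm]; exact (mem_ball.1 hy).le) hz
          _ = R / 2 := by ring)
      (fun σ hσ => hEw σ (hs.trans hσ.1) (hσ.2.le.trans ht0))
      (fun σ hσ => hEwt σ (hs.trans hσ.1) (hσ.2.le.trans ht0))
    rw [norm_sub_rev] at hdiff
    have hcommz := hcomm z
    rw [hχz, one_smul] at hcommz
    have hsum : (4 * D₁ * (1 / R) + D₂ * E' * ((1 + M) / R ^ 4)) * Real.sqrt (t - s) +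
        64 * (1 / R ^ 2) * (t - s) + 8192 * CK * E' * ((1 + M) / R ^ 4) * (t - s) +
        Gf * M⁻¹ * (t - s) ≤ Q * (1 / R + 1 / R ^ 2 + (1 + M) / R ^ 4 + M⁻¹) * (Real.sqrt (t - s) + (t - s)) := by
      have hl0 : 0 ≤ t - s := hh.le
      have hs0' : 0 ≤ Real.sqrt (t - s) := Real.sqrt_nonneg _
      have hA1 : 0 ≤ 4 * D₁ * (1 / R) := by positivity
      have hA2 : 0 ≤ 64 * (1 / R ^ 2) := by positivity
      have hA3 : 0 ≤ D₂ * E' * ((1 + M) / R ^ 4) := by positivity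
      have hA4 : 0 ≤ 8192 * CK * E' * ((1 + M) / R ^ 4) := by positivity
      have hA5 : 0 ≤ Gf * M⁻¹ := by positivity
      calc (4 * D₁ * (1 / R) + D₂ * E' * ((1 + M) / R ^ 4)) * Real.sqrt (t - s) +
            64 * (1 / R ^ 2) * (t - s) + 8192 * CK * E' * ((1 + M) / R ^ 4) * (t - s) +
            Gf * M⁻¹ * (t - s)
          ≤ (4 * D₁ * (1 / R) + 64 * (1 / R ^ 2) + (D₂ * E' + 8192 * CK * E') * ((1 + M) / R ^ 4) +
              Gf * M⁻¹) * (Real.sqrt (t - s) + (t - s)) := by nlinarith [mul_nonneg hA1 hl0, mul_nonneg hA2 hs0', mul_nonneg hA3 hl0, mul_nonneg hA4 hs0', mul_nonneg hA5 hs0']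
        _ ≤ Q * (1 / R + 1 / R ^ 2 + (1 + M) / R ^ 4 + M⁻¹) * (Real.sqrt (t - s) + (t - s)) := mul_le_mul_of_nonneg_right hQdom (by positivity)
    calc ‖(UnboundedOperators.heatExtension (w s) (t - s) z -
            UnboundedOperators.heatExtension (wt s) (t - s) z) +
          (oseenDuhamel 1 s wt wt t z - oseenDuhamel 1 s w w t z) +
          (w t z - UnboundedOperators.heatExtension (w s) (t - s) z + oseenDuhamel 1 s w w t z)‖
        ≤ ‖UnboundedOperators.heatExtension (w s) (t - s) z -
            UnboundedOperators.heatExtension (wt s) (t - s) z‖ +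
          ‖oseenDuhamel 1 s wt wt t z - oseenDuhamel 1 s w w t z‖ +
          ‖w t z - UnboundedOperators.heatExtension (w s) (t - s) z + oseenDuhamel 1 s w w t z‖ := norm_add₃_le
      _ ≤ ((4 * D₁ * (1 / R) + D₂ * E' * ((1 + M) / R ^ 4)) * Real.sqrt (t - s) +
            64 * (1 / R ^ 2) * (t - s)) +
          8192 * CK * E' * ((1 + M) / R ^ 4) * (t - s) +
          Gf * M⁻¹ * (t - s) := add_le_add (add_le_add hcommz hdiff) (hFle' z)
      _ ≤ Q * (1 / R + 1 / R ^ 2 + (1 + M) / R ^ 4 + M⁻¹) * (Real.sqrt (t - s) + (t - s)) := by linarith only [hsum]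
end ClayBlowup
end Summit.NavierStokesRegularity.FluidComputer
end
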